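import Summits.PneNP.PneNP.Theorems.ChebyshevTracialDesignTightEvenClosedForm
import HarnessLib

/-!
# Cell pnp-psdrank, route `ChebyshevTracialDesign`: the ratio of consecutive even eigenvalues of the tight Gram kernel
# (MEMO-7(prover) §E (P), increment form) — the even tight spectrum DECREASES

Harmonic backbone of the `r = 1` rung of the crux `TracialDecayExp20` (stmt-PneNP-19878). From the sum-free closed form
`…TightEvenClosedForm.kernelEigen_tight_even_closed` (p447952; prover's (★★) p444684 + this seat's (S) p447718 + ladder closed form
p447163) and four elementary identities (`pm(s+2) = (s+1)pm(s)`, the two-step Pascal relations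
`C(A,B)·B·(A−B) = A(A−1)·C(A−2,B−1)`, and a shift of the product `Π_{i<κ}(x−2i)`):
* `kernelEigen_tight_even_succ_mul` : for even `n`, `t = 2c+1`, `2t ≤ n`, `κ'+1 ≤ c`, with `κ` the Gram class function of the
  tight incidence on the `t`-subsets,
  `λ_{2κ'+2} · (n−2κ')(t−2κ')(n−t−2κ') = λ_{2κ'} · (2κ'+1)(t−1−2κ')(n−t−1−2κ')`
  — the increment form of (P) `λ_{2κ}/λ₀ = (2κ−1)‼·Π_{i<κ}(t−1−2i)(n−t−1−2i)/((t−2i)(n−t−2i)(n−2i))` (prover's `kernelEigen_two_mul_eq`,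
  p446018, is the case `κ' = 0`);
* `kernelEigen_tight_even_succ_le` : hence `λ_{2κ'+2} ≤ λ_{2κ'} · (2κ'+1)/(n−2κ')` and in particular the even eigenvalues are
  non-increasing in `κ'` — the monotonicity half of referee flag n11 (`max_{κ'≥1} λ_{2κ'} = λ₂`).
[cite: GodsilMeagher2015, §15.2 (perfect matching scheme)] WHAT THIS IS NOT: not the σ₂ tail sum bound itself (one geometric
series away), nothing on psd rank. Supports crux stmt-PneNP-19878.
-/

set_option linter.dupNamespace false -- `Summit.PneNP.PneNP.…`: summit = sub-problem (D-0017)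

noncomputable section

namespace Summit.PneNP.PneNP.Theorems.ChebyshevTracialDesignTightEvenRatio

open Finset Literature.Barriers.PneNP Literature.Combinatorics.AssociationSchemes
open Literature.Combinatorics.AssociationSchemes.JohnsonHarmonics
open Literature.Combinatorics.AssociationSchemes.JohnsonSpectrum
open Summit.PneNP.PneNP.Theorems.ChebyshevTracialDesignClosedPairCount
open Summit.PneNP.PneNP.Theorems.ChebyshevTracialDesignTightEvenClosedForm

variable {n : ℕ}

/-! ### §1 Three elementary identities -/

/-- Shift of the stride-2 falling product: `(x+2)·Π_{i≤κ}(x−2i) = Π_{i<κ}(x+2−2i)·(x+2−2κ)(x−2κ)`. [folklore] -/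
theorem prod_stride_two_shift (x : ℝ) : ∀ κ : ℕ,
    (x + 2) * ∏ i ∈ range (κ + 1), (x - 2 * i) = (∏ i ∈ range κ, (x + 2 - 2 * i)) * ((x + 2 - 2 * κ) * (x - 2 * κ))
  | 0 => by simp
  | κ + 1 => by
    rw [prod_range_succ _ (κ + 1), ← mul_assoc, prod_stride_two_shift x κ, prod_range_succ _ κ]
    push_cast
    ring

/-- Two Pascal steps: `C(A,B)·B·(A−B) = A·(A−1)·C(A−2,B−1)` for `1 ≤ B`, `B + 1 ≤ A`. [folklore] -/
theorem choose_two_step {A B : ℕ} (hB : 1 ≤ B) (hAB : B + 1 ≤ A) :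
    ((A.choose B : ℕ) : ℝ) * B * ((A : ℝ) - B) = (A : ℝ) * ((A : ℝ) - 1) * ((A - 2).choose (B - 1) : ℕ) := by
  have h1 : A * (A - 1).choose (B - 1) = A.choose B * B := by
    have := Nat.add_one_mul_choose_eq (A - 1) (B - 1)
    rw [show A - 1 + 1 = A by omega, show B - 1 + 1 = B by omega] at this
    exact this
  have h2 : (A - 2).choose (B - 1) * (A - 1) = (A - 1).choose (B - 1) * (A - B) := by
    have := Nat.choose_mul_succ_eq (A - 2) (B - 1)
    rw [show A - 2 + 1 = A - 1 by omega, show A - 1 - (B - 1) = A - B by omega] at this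
    exact this
  have h3 : A.choose B * B * (A - B) = A * (A - 1) * (A - 2).choose (B - 1) := by
    calc A.choose B * B * (A - B) = A * ((A - 1).choose (B - 1) * (A - B)) := by rw [← h1]; ring
      _ = A * ((A - 2).choose (B - 1) * (A - 1)) := by rw [h2]
      _ = A * (A - 1) * (A - 2).choose (B - 1) := by ring
  have h4 := congrArg (Nat.cast (R := ℝ)) h3
  push_cast [show B ≤ A by omega, show 1 ≤ A by omega] at h4
  exact h4

/-- `pm(m+4) = (m+3)(m+1)·pm(m)`. [folklore] -/
theorem pmCount_add_four (m : ℕ) : (pmCount (m + 4) : ℝ) = ((m : ℝ) + 3) * ((m : ℝ) + 1) * pmCount m := by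
  have h1 := succ_mul_pmCount m
  have h2 := succ_mul_pmCount (m + 2)
  rw [show m + 2 + 2 = m + 4 by ring] at h2
  have h1' : (((m + 1 : ℕ) : ℝ)) * pmCount m = pmCount (m + 2) := by exact_mod_cast h1
  have h2' : (((m + 2 + 1 : ℕ) : ℝ)) * pmCount (m + 2) = pmCount (m + 4) := by exact_mod_cast h2
  rw [← h2', ← h1']
  push_cast
  ring

/-! ### §2 The algebra of the increment (abstract real variables) -/

/-- Left chain: substitute `R3`, `R5a`, `R1`, `R4` into the new eigenvalue times the multiplier. [folklore] -/
theorem left_chain (x k g C0 C1 D0 Dm p0 p1 q4 Pn Po : ℝ) (R1 : p1 = (2 * k + 1) * p0)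
    (R3 : (2 * x - 2 * (k + 1) + 2) * Pn = Po * ((2 * x - 2 * (k + 1) + 2 - 2 * k) * (2 * x - 2 * (k + 1) - 2 * k)))
    (R4 : C0 * (g - k) * (x - 2 * k - (g - k)) = (x - 2 * k) * (x - 2 * k - 1) * C1)
    (R5a : D0 * (2 * g + 1 - 2 * k) * (2 * x - 4 * k - (2 * g + 1 - 2 * k)) = (2 * x - 4 * k) * (2 * x - 4 * k - 1) * Dm) :
    (((2 * x - 2 * g - 2 * (k + 1)) * C1) ^ 2 * (p1 * q4 * Pn) *
        ((2 * x - 2 * k) * (2 * g + 1 - 2 * k) * (2 * x - (2 * g + 1) - 2 * k)) * D0) *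
        ((2 * x - 4 * k - 2) * (2 * x - 4 * k - 3) * ((x - 2 * k) * (x - 2 * k - 1)) ^ 2) =
      (2 * x - 2 * g - 2 * (k + 1)) ^ 2 * (C0 * (g - k) * (x - 2 * k - (g - k))) ^ 2 * ((2 * k + 1) * p0) * q4 * Po *
        (2 * x - 4 * k) ^ 2 * (2 * x - 4 * k - 2) ^ 2 * (2 * x - 4 * k - 1) * (2 * x - 4 * k - 3) * Dm := by
  have L1 : (((2 * x - 2 * g - 2 * (k + 1)) * C1) ^ 2 * (p1 * q4 * Pn) *
        ((2 * x - 2 * k) * (2 * g + 1 - 2 * k) * (2 * x - (2 * g + 1) - 2 * k)) * D0) *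
        ((2 * x - 4 * k - 2) * (2 * x - 4 * k - 3) * ((x - 2 * k) * (x - 2 * k - 1)) ^ 2) =
      (2 * x - 2 * g - 2 * (k + 1)) ^ 2 * C1 ^ 2 * p1 * q4 * (Po * ((2 * x - 4 * k) * (2 * x - 4 * k - 2))) *
        ((2 * g + 1 - 2 * k) * (2 * x - (2 * g + 1) - 2 * k) * D0) *
        ((2 * x - 4 * k - 2) * (2 * x - 4 * k - 3) * ((x - 2 * k) * (x - 2 * k - 1)) ^ 2) := by
    linear_combination ((2 * x - 2 * g - 2 * (k + 1)) ^ 2 * C1 ^ 2 * p1 * q4 *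
        ((2 * g + 1 - 2 * k) * (2 * x - (2 * g + 1) - 2 * k) * D0) *
        ((2 * x - 4 * k - 2) * (2 * x - 4 * k - 3) * ((x - 2 * k) * (x - 2 * k - 1)) ^ 2)) * R3
  have L2 : (2 * x - 2 * g - 2 * (k + 1)) ^ 2 * C1 ^ 2 * p1 * q4 * (Po * ((2 * x - 4 * k) * (2 * x - 4 * k - 2))) *
        ((2 * g + 1 - 2 * k) * (2 * x - (2 * g + 1) - 2 * k) * D0) *
        ((2 * x - 4 * k - 2) * (2 * x - 4 * k - 3) * ((x - 2 * k) * (x - 2 * k - 1)) ^ 2) =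
      (2 * x - 2 * g - 2 * (k + 1)) ^ 2 * C1 ^ 2 * p1 * q4 * Po * (2 * x - 4 * k) * (2 * x - 4 * k - 2) *
        ((2 * x - 4 * k) * (2 * x - 4 * k - 1) * Dm) *
        ((2 * x - 4 * k - 2) * (2 * x - 4 * k - 3) * ((x - 2 * k) * (x - 2 * k - 1)) ^ 2) := by
    linear_combination ((2 * x - 2 * g - 2 * (k + 1)) ^ 2 * C1 ^ 2 * p1 * q4 * Po * (2 * x - 4 * k) * (2 * x - 4 * k - 2) *
        ((2 * x - 4 * k - 2) * (2 * x - 4 * k - 3) * ((x - 2 * k) * (x - 2 * k - 1)) ^ 2)) * R5a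
  have L3 : (2 * x - 2 * g - 2 * (k + 1)) ^ 2 * C1 ^ 2 * p1 * q4 * Po * (2 * x - 4 * k) * (2 * x - 4 * k - 2) *
        ((2 * x - 4 * k) * (2 * x - 4 * k - 1) * Dm) *
        ((2 * x - 4 * k - 2) * (2 * x - 4 * k - 3) * ((x - 2 * k) * (x - 2 * k - 1)) ^ 2) =
      (2 * x - 2 * g - 2 * (k + 1)) ^ 2 * ((x - 2 * k) * (x - 2 * k - 1) * C1) ^ 2 * ((2 * k + 1) * p0) * q4 * Po *
        (2 * x - 4 * k) ^ 2 * (2 * x - 4 * k - 2) ^ 2 * (2 * x - 4 * k - 1) * (2 * x - 4 * k - 3) * Dm := by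
    rw [R1]; ring
  rw [L1, L2, L3, ← R4]

/-- Right chain: substitute `R2`, `R5b` into the old eigenvalue times the multiplier. [folklore] -/
theorem right_chain (x k g C0 D2 Dm p0 q0 q4 Po : ℝ)
    (R2 : q0 = (2 * x - 4 * k - 4 + 3) * (2 * x - 4 * k - 4 + 1) * q4)
    (R5b : Dm * (2 * g + 1 - 2 * k - 1) * (2 * x - 4 * k - 2 - (2 * g + 1 - 2 * k - 1)) =
      (2 * x - 4 * k - 2) * (2 * x - 4 * k - 2 - 1) * D2) :
    (((2 * x - 2 * g - 2 * k) * C0) ^ 2 * (p0 * q0 * Po) * ((2 * k + 1) * (2 * g - 2 * k) * (2 * x - (2 * g + 2) - 2 * k)) * D2) *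
        ((2 * x - 4 * k - 2) * (2 * x - 4 * k - 3) * ((x - 2 * k) * (x - 2 * k - 1)) ^ 2) =
      (2 * x - 2 * g - 2 * k) ^ 2 * C0 ^ 2 * p0 * ((2 * x - 4 * k - 4 + 3) * (2 * x - 4 * k - 4 + 1) * q4) * Po *
        ((2 * k + 1) * (2 * g - 2 * k) * (2 * x - (2 * g + 2) - 2 * k)) *
        (Dm * (2 * g + 1 - 2 * k - 1) * (2 * x - 4 * k - 2 - (2 * g + 1 - 2 * k - 1))) *
        ((x - 2 * k) * (x - 2 * k - 1)) ^ 2 := by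
  rw [R2]
  linear_combination (-((2 * x - 2 * g - 2 * k) ^ 2 * C0 ^ 2 * p0 * ((2 * x - 4 * k - 4 + 3) * (2 * x - 4 * k - 4 + 1) * q4) * Po *
        ((2 * k + 1) * (2 * g - 2 * k) * (2 * x - (2 * g + 2) - 2 * k)) * ((x - 2 * k) * (x - 2 * k - 1)) ^ 2)) * R5b

/-- The increment identity in abstract form (cross-multiplied): from the five relations, the new and old closed forms
satisfy `new·(n−2κ)(t−2κ)(n−t−2κ)·D0 = old·(2κ+1)(t−1−2κ)(n−t−1−2κ)·D2`. [folklore] -/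
theorem increment_identity (x k g C0 C1 D0 D2 Dm p0 p1 q0 q4 Pn Po : ℝ) (R1 : p1 = (2 * k + 1) * p0)
    (R2 : q0 = (2 * x - 4 * k - 4 + 3) * (2 * x - 4 * k - 4 + 1) * q4)
    (R3 : (2 * x - 2 * (k + 1) + 2) * Pn = Po * ((2 * x - 2 * (k + 1) + 2 - 2 * k) * (2 * x - 2 * (k + 1) - 2 * k)))
    (R4 : C0 * (g - k) * (x - 2 * k - (g - k)) = (x - 2 * k) * (x - 2 * k - 1) * C1)
    (R5a : D0 * (2 * g + 1 - 2 * k) * (2 * x - 4 * k - (2 * g + 1 - 2 * k)) = (2 * x - 4 * k) * (2 * x - 4 * k - 1) * Dm)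
    (R5b : Dm * (2 * g + 1 - 2 * k - 1) * (2 * x - 4 * k - 2 - (2 * g + 1 - 2 * k - 1)) =
      (2 * x - 4 * k - 2) * (2 * x - 4 * k - 2 - 1) * D2)
    (hM : (2 * x - 4 * k - 2) * (2 * x - 4 * k - 3) * ((x - 2 * k) * (x - 2 * k - 1)) ^ 2 ≠ 0) :
    ((2 * x - 2 * g - 2 * (k + 1)) * C1) ^ 2 * (p1 * q4 * Pn) *
        ((2 * x - 2 * k) * (2 * g + 1 - 2 * k) * (2 * x - (2 * g + 1) - 2 * k)) * D0 =
      ((2 * x - 2 * g - 2 * k) * C0) ^ 2 * (p0 * q0 * Po) * ((2 * k + 1) * (2 * g - 2 * k) * (2 * x - (2 * g + 2) - 2 * k)) * D2 := by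
  refine mul_right_cancel₀ hM ?_
  rw [left_chain x k g C0 C1 D0 Dm p0 p1 q4 Pn Po R1 R3 R4 R5a, right_chain x k g C0 D2 Dm p0 q0 q4 Po R2 R5b]
  ring

/-! ### §3 The ratio of consecutive even eigenvalues -/

/-- **Increment form of (P).** For even `n`, `t = 2c+1` with `2t ≤ n`, `κ'+1 ≤ c`, and `κ` the Gram class function of the
tight incidence on the `t`-subsets:
`λ_{2κ'+2}·(n−2κ')(t−2κ')(n−t−2κ') = λ_{2κ'}·(2κ'+1)(t−1−2κ')(n−t−1−2κ')`. [cite: GodsilMeagher2015, §15.2] -/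
theorem kernelEigen_tight_even_succ_mul {c κ' : ℕ} (hn : Even n) (ht : 2 * (2 * c + 1) ≤ n) (hκc : κ' + 1 ≤ c)
    (κ : ℕ → ℝ)
    (hA : ∀ U ∈ univ.powersetCard (2 * c + 1), ∀ U' ∈ univ.powersetCard (2 * c + 1),
      ∑ M : PMatch n, (if (U.filter fun x => M.2.partner x ∉ U).card = 1 then (1 : ℝ) else 0) *
        (if (U'.filter fun x => M.2.partner x ∉ U').card = 1 then (1 : ℝ) else 0) = κ (U ∩ U').card) :
    kernelEigen n (2 * c + 1) (2 * (κ' + 1)) κ *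
        (((n : ℝ) - 2 * κ') * ((2 * c + 1 : ℝ) - 2 * κ') * ((n : ℝ) - (2 * c + 1) - 2 * κ')) =
      kernelEigen n (2 * c + 1) (2 * κ') κ *
        ((2 * κ' + 1 : ℝ) * ((2 * c : ℝ) - 2 * κ') * ((n : ℝ) - (2 * c + 2) - 2 * κ')) := by
  rw [kernelEigen_tight_even_closed hn ht (by omega : κ' + 1 ≤ c) κ hA, kernelEigen_tight_even_closed hn ht (by omega : κ' ≤ c) κ hA]
  obtain ⟨N, hN⟩ := hn
  have hnN : n = 2 * N := by omega
  subst hnN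
  -- names: A = N − 2κ', B = c − κ', A' = 2N − 4κ', B' = 2c+1−2κ'
  have hA2 : 2 * N / 2 = N := by omega
  rw [hA2]
  rw [show N - 2 * (κ' + 1) = N - 2 * κ' - 2 by omega, show c - (κ' + 1) = c - κ' - 1 by omega,
    show 2 * N - 4 * (κ' + 1) = 2 * N - 4 * κ' - 4 by omega,
    show 2 * c + 1 - 2 * (κ' + 1) = 2 * c + 1 - 2 * κ' - 2 by omega]
  -- the four relations
  have R1 : (pmCount (2 * (κ' + 1)) : ℝ) = (2 * κ' + 1 : ℝ) * pmCount (2 * κ') := by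
    have h := succ_mul_pmCount (2 * κ')
    rw [show 2 * κ' + 2 = 2 * (κ' + 1) by ring] at h
    have h' : (((2 * κ' + 1 : ℕ) : ℝ)) * pmCount (2 * κ') = pmCount (2 * (κ' + 1)) := by exact_mod_cast h
    rw [← h']; push_cast; ring
  have R2 : (pmCount (2 * N - 4 * κ') : ℝ) =
      (((2 * N - 4 * κ' - 4 : ℕ) : ℝ) + 3) * (((2 * N - 4 * κ' - 4 : ℕ) : ℝ) + 1) * pmCount (2 * N - 4 * κ' - 4) := by
    rw [← pmCount_add_four, show 2 * N - 4 * κ' - 4 + 4 = 2 * N - 4 * κ' by omega]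
  have R3 := prod_stride_two_shift ((2 * N : ℕ) - 2 * ((κ' : ℝ) + 1)) κ'
  have R4 := choose_two_step (A := N - 2 * κ') (B := c - κ') (by omega) (by omega)
  have R5a := choose_two_step (A := 2 * N - 4 * κ') (B := 2 * c + 1 - 2 * κ') (by omega) (by omega)
  have R5b := choose_two_step (A := 2 * N - 4 * κ' - 2) (B := 2 * c + 1 - 2 * κ' - 1) (by omega) (by omega)
  rw [show N - 2 * κ' - 2 = N - 2 * κ' - 2 from rfl] at R4
  rw [show 2 * N - 4 * κ' - 2 - 2 = 2 * N - 4 * κ' - 4 by omega,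
    show 2 * c + 1 - 2 * κ' - 1 - 1 = 2 * c + 1 - 2 * κ' - 2 by omega] at R5b
  -- positivity of what we divide by
  have hB : (1 : ℝ) ≤ ((c - κ' : ℕ) : ℝ) := by exact_mod_cast (show 1 ≤ c - κ' by omega)
  have hc1 : (0 : ℝ) < (((N - 2 * κ' - 2).choose (c - κ' - 1) : ℕ) : ℝ) := by exact_mod_cast Nat.choose_pos (by omega)
  have hc2 : (0 : ℝ) < (((2 * N - 4 * κ' - 4).choose (2 * c + 1 - 2 * κ' - 2) : ℕ) : ℝ) := by
    exact_mod_cast Nat.choose_pos (by omega)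
  have hc3 : (0 : ℝ) < (((2 * N - 4 * κ').choose (2 * c + 1 - 2 * κ') : ℕ) : ℝ) := by
    exact_mod_cast Nat.choose_pos (by omega)
  have hc4 : (0 : ℝ) < (((N - 2 * κ').choose (c - κ') : ℕ) : ℝ) := by exact_mod_cast Nat.choose_pos (by omega)
  have hc5 : (0 : ℝ) < (((2 * N - 4 * κ' - 2).choose (2 * c + 1 - 2 * κ' - 1) : ℕ) : ℝ) := by
    exact_mod_cast Nat.choose_pos (by omega)
  -- express the big binomials through the small ones
  push_cast [show 2 * κ' ≤ N by omega, show κ' ≤ c by omega, show 4 * κ' ≤ 2 * N by omega, show 2 * κ' ≤ 2 * c + 1 by omega,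
    show 4 ≤ 2 * N - 4 * κ' by omega, show 2 ≤ 2 * c + 1 - 2 * κ' by omega, show 2 ≤ N - 2 * κ' by omega,
    show 1 ≤ c - κ' by omega, show 2 ≤ 2 * N - 4 * κ' by omega, show 1 ≤ 2 * c + 1 - 2 * κ' by omega] at R1 R2 R3 R4 R5a R5b ⊢
  -- numeric lower bounds: N ≥ 2c + 1 ≥ 2κ' + 3
  have hNk : (2 * κ' + 3 : ℝ) ≤ N := by exact_mod_cast (show 2 * κ' + 3 ≤ N by omega)
  have hcκ : (κ' + 1 : ℝ) ≤ c := by exact_mod_cast (show κ' + 1 ≤ c by omega)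
  have hNc : (2 * c + 1 : ℝ) ≤ N := by exact_mod_cast (show 2 * c + 1 ≤ N by omega)
  -- the product in R3 is the old product
  have hPold : ∏ x ∈ range κ', (2 * (N : ℝ) - 2 * ((κ' : ℝ) + 1) + 2 - 2 * (x : ℝ)) =
      ∏ x ∈ range κ', (2 * (N : ℝ) - 2 * (κ' : ℝ) - 2 * (x : ℝ)) := prod_congr rfl fun x _ => by ring
  rw [hPold] at R3
  -- abbreviations
  set x : ℝ := (N : ℝ) with hx
  set k : ℝ := (κ' : ℝ) with hk
  set g : ℝ := (c : ℝ) with hg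
  set C1 : ℝ := (((N - 2 * κ' - 2).choose (c - κ' - 1) : ℕ) : ℝ) with hC1
  set C0 : ℝ := (((N - 2 * κ').choose (c - κ') : ℕ) : ℝ) with hC0
  set D0 : ℝ := (((2 * N - 4 * κ').choose (2 * c + 1 - 2 * κ') : ℕ) : ℝ) with hD0
  set Dm : ℝ := (((2 * N - 4 * κ' - 2).choose (2 * c + 1 - 2 * κ' - 1) : ℕ) : ℝ) with hDm
  set D2 : ℝ := (((2 * N - 4 * κ' - 4).choose (2 * c + 1 - 2 * κ' - 2) : ℕ) : ℝ) with hD2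
  set p1 : ℝ := (pmCount (2 * (κ' + 1)) : ℝ) with hp1
  set p0 : ℝ := (pmCount (2 * κ') : ℝ) with hp0
  set q0 : ℝ := (pmCount (2 * N - 4 * κ') : ℝ) with hq0
  set q4 : ℝ := (pmCount (2 * N - 4 * κ' - 4) : ℝ) with hq4
  set Pn : ℝ := ∏ i ∈ range (κ' + 1), (2 * x - 2 * (k + 1) - 2 * (i : ℝ)) with hPn
  set Po : ℝ := ∏ i ∈ range κ', (2 * x - 2 * k - 2 * (i : ℝ)) with hPo
  -- cross-multiply and apply the abstract identity
  have hD2ne : D2 ≠ 0 := ne_of_gt hc2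
  have hD0ne : D0 ≠ 0 := ne_of_gt hc3
  rw [div_mul_eq_mul_div, div_mul_eq_mul_div, div_eq_div_iff hD2ne hD0ne]
  have hM : (2 * x - 4 * k - 2) * (2 * x - 4 * k - 3) * ((x - 2 * k) * (x - 2 * k - 1)) ^ 2 ≠ 0 := by
    have h1 : 0 < 2 * x - 4 * k - 2 := by linarith
    have h2 : 0 < 2 * x - 4 * k - 3 := by linarith
    have h3 : 0 < (x - 2 * k) * (x - 2 * k - 1) := mul_pos (by linarith) (by linarith)
    positivity
  linear_combination increment_identity x k g C0 C1 D0 D2 Dm p0 p1 q0 q4 Pn Po R1 R2 R3 R4 R5a R5b hM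

/-- **The even tight eigenvalues decrease:** under the same hypotheses,
`λ_{2κ'+2} ≤ λ_{2κ'} · (2κ'+1)/(n−2κ')` (so `λ_{2κ'+2} < λ_{2κ'}` whenever `λ_{2κ'} > 0`, and `λ_{2κ'+2} ≤ λ_{2κ'}` always).
[cite: GodsilMeagher2015, §15.2] -/
theorem kernelEigen_tight_even_succ_le {c κ' : ℕ} (hn : Even n) (ht : 2 * (2 * c + 1) ≤ n) (hκc : κ' + 1 ≤ c)
    (κ : ℕ → ℝ)
    (hA : ∀ U ∈ univ.powersetCard (2 * c + 1), ∀ U' ∈ univ.powersetCard (2 * c + 1),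
      ∑ M : PMatch n, (if (U.filter fun x => M.2.partner x ∉ U).card = 1 then (1 : ℝ) else 0) *
        (if (U'.filter fun x => M.2.partner x ∉ U').card = 1 then (1 : ℝ) else 0) = κ (U ∩ U').card) :
    kernelEigen n (2 * c + 1) (2 * (κ' + 1)) κ ≤
      kernelEigen n (2 * c + 1) (2 * κ') κ * ((2 * κ' + 1 : ℝ) / ((n : ℝ) - 2 * κ')) := by
  have h := kernelEigen_tight_even_succ_mul hn ht hκc κ hA
  have hNk : (4 * κ' + 6 : ℝ) ≤ n := by exact_mod_cast (show 4 * κ' + 6 ≤ n by omega)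
  have hcκ : (κ' + 1 : ℝ) ≤ c := by exact_mod_cast (show κ' + 1 ≤ c by omega)
  have hNc : (4 * c + 2 : ℝ) ≤ n := by exact_mod_cast (show 4 * c + 2 ≤ n by omega)
  -- nonnegativity of λ_{2κ'} from the closed form
  have hpos0 : 0 ≤ kernelEigen n (2 * c + 1) (2 * κ') κ := by
    rw [kernelEigen_tight_even_closed hn ht (by omega) κ hA]
    apply div_nonneg _ (Nat.cast_nonneg _)
    apply mul_nonneg (sq_nonneg _)
    apply mul_nonneg (mul_nonneg (Nat.cast_nonneg _) (Nat.cast_nonneg _))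
    exact prod_nonneg fun i hi => by
      have hi' := mem_range.1 hi
      have : (i : ℝ) + 1 ≤ κ' := by exact_mod_cast hi'
      linarith
  have hf1 : 0 < ((n : ℝ) - 2 * κ') := by linarith
  have hf2 : 0 < ((2 * c + 1 : ℝ) - 2 * κ') := by linarith
  have hf3 : 0 < ((n : ℝ) - (2 * c + 1) - 2 * κ') := by linarith
  have hF : 0 < ((n : ℝ) - 2 * κ') * ((2 * c + 1 : ℝ) - 2 * κ') * ((n : ℝ) - (2 * c + 1) - 2 * κ') := by positivity
  have hlam : kernelEigen n (2 * c + 1) (2 * (κ' + 1)) κ =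
      kernelEigen n (2 * c + 1) (2 * κ') κ * ((2 * κ' + 1 : ℝ) * ((2 * c : ℝ) - 2 * κ') * ((n : ℝ) - (2 * c + 2) - 2 * κ')) /
        (((n : ℝ) - 2 * κ') * ((2 * c + 1 : ℝ) - 2 * κ') * ((n : ℝ) - (2 * c + 1) - 2 * κ')) := by
    rw [eq_div_iff hF.ne']
    exact h
  rw [hlam, div_le_iff₀ hF]
  have hrhs : kernelEigen n (2 * c + 1) (2 * κ') κ * ((2 * κ' + 1 : ℝ) / ((n : ℝ) - 2 * κ')) *
      (((n : ℝ) - 2 * κ') * ((2 * c + 1 : ℝ) - 2 * κ') * ((n : ℝ) - (2 * c + 1) - 2 * κ')) =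
      kernelEigen n (2 * c + 1) (2 * κ') κ * (2 * κ' + 1 : ℝ) * (((2 * c + 1 : ℝ) - 2 * κ') * ((n : ℝ) - (2 * c + 1) - 2 * κ')) := by
    field_simp
  rw [hrhs, show kernelEigen n (2 * c + 1) (2 * κ') κ * ((2 * κ' + 1 : ℝ) * ((2 * c : ℝ) - 2 * κ') * ((n : ℝ) - (2 * c + 2) - 2 * κ')) =
    kernelEigen n (2 * c + 1) (2 * κ') κ * (2 * κ' + 1 : ℝ) * (((2 * c : ℝ) - 2 * κ') * ((n : ℝ) - (2 * c + 2) - 2 * κ')) by ring]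
  apply mul_le_mul_of_nonneg_left _ (mul_nonneg hpos0 (by positivity))
  apply mul_le_mul (by linarith) (by linarith) (by linarith) (by linarith)

end Summit.PneNP.PneNP.Theorems.ChebyshevTracialDesignTightEvenRatio
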